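import Mathlib
import Summits.NavierStokesRegularity.NavierStokesRegularity.Theorems.TaoLadderRungTwoFlatCertificateGlueMeshOn
import Summits.NavierStokesRegularity.NavierStokesRegularity.Theorems.TaoLadderRungTwoBreakDSSWaveOfBallDatum
import HarnessLib

/-!
# The one-shift renormalisation map on TRAJECTORY space — definitions
# (cell harvest/h2-tao-ladder, seat p2; objects posited by the kernel plan for the last non-kernel link of
# K1(1) = `NoSurvivingDSSOne`, stmt-NavierStokesRegularity-20205; rung1/KERNEL-STAGE3-PLAN.md)

MODEL lattice ODEs only (Tao 2016 §4 normal form on Tao's shift set `S`); nothing here is a statement about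
the Navier–Stokes equations; nothing is asserted — this module only DEFINES objects.

p2's STAGE 2/3 (rung1/STAGE2-LEMMA.md, rung1/STAGE3-BANACH.md) obtain a one-shift DSS datum of the bi-infinite
lattice as the fixed point of a map `𝒯 = (N, Wmap, Vmap)` on (window box) × (wake ball) × (top ball); the
tree theorem `DSSOneShift.exists_inTableClass_surviving_dssWave_of_circuitBallDatum` (p619300) turns such a
datum into a surviving admissible DSS wave. To put the fixed-point step itself into the kernel WITHOUT an
existence theory for the infinite-dimensional lattice ODE, the unknown is taken to be
`u = (window start state, flight time, the tail TRAJECTORIES over the flight)` and `𝒯` is «Picard + shift» in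
one stroke: a fixed point is simultaneously an exact solution on the flight and a one-shift datum. This file
fixes the vocabulary:

* `OneShiftFrame` — the static numbers (window `[0, W)`, centre, box radii, flight-time centre/radius, tail
  tube centres/radii, metric weights, edge bounds);
* `OneShiftFrame.Space` — the ambient Banach space `(Fin m → Fin W → ℝ) × ℝ × ℓ^∞(Fin m × ℤ × [0, τ_hi])`
  (SCALED coordinates: box and tubes become unit-free balls; its max-norm IS the weighted sup metric of
  STAGE3-BANACH §1 with identity block scales);
* `decodeY`, `decodeTau`, `decodeTail` and the admissible set `OneShiftFrame.Adm` (box × tubes × continuity in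
  time);
* `OneShiftWindowCert` — the HYPOTHESIS STRUCTURE describing the finite window system exactly as p2's
  interval engine certifies it: a window-run map `Φ` (p1's `CertificateGlueOn.WindowRun` on `S` with the wake
  shell `-1` and the top shell `W` as continuous edge inputs) and the Krawczyk map `Nmap` of the window block
  with its fixed-point characterisation (one-shift relations on the window + section); the quantitative
  (H-win)/(H-lip) constants are NOT part of this structure (they enter later proof files as hypotheses);
* `gfac` (renormalisation factor `(Σ_i z_{i,1}²)^{-1/2}`), `fullFamily`, `tailRaw` (the Picard-shift formula
  `g·S_{i,k+1}(τ) + ∫_0^t quadTerm_{i,k}(S)`), and `oneShiftMap` = post-clamp ∘ raw map ∘ pre-clamp (the clamps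
  make it a total self-map of `Space` with no hypotheses; on `Adm`, under the self-map inequalities of STAGE 2,
  the clamps are inactive).
-/

noncomputable section

-- `Summit.NavierStokesRegularity.NavierStokesRegularity.…` is the tree's (summit = problem) namespace; the
-- duplicated component is intended, so the dupNamespace linter is silenced for this file.
set_option linter.dupNamespace false

namespace Summit.NavierStokesRegularity.NavierStokesRegularity.Theorems

namespace DSSOneShift

open Set MeasureTheory intervalIntegral
open Literature.Analysis.FluidPDE Literature.Analysis.FluidPDE.TaoCascade CertificateGlueOn

variable {m : ℕ}

/-! ### Static data -/

/-- **The static frame of a one-shift certificate** (all numbers are read off an engine row; nothing is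
asserted about them here): window `[0, W)` with section site `D`, box centre `yc` and radii `a` on the window
shells, flight-time centre `τc` and radius `rτ` (so the flight interval is `[0, τc + rτ]`), tail tube centres
`tubeC` and radii `tubeR` (wake shells `k ≤ -1`: centre `ĝ^{|k|} ŷ_{·,0}`, radius incl. the in-flight drift;
top shells `k ≥ W`: centre `0`, radius `ε Γ^{-(k-W)}`), metric weights `wt` of the tail shells (`(ĝζ′)^{|k|}`
resp. `ε′Γ′^{-(k-W)}`), the uniform ratio bound `B` (`tubeR k ≤ B · wt k`, `|tubeC| ≤ B · wt`), the edge
sup bounds `Eb`, `Et` of p1's `WindowRun`, and the section level `strig`.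
[cite: Tao2016AveragedNS, §4 (4.1), (4.8) (the lattice whose DSS data these frames describe); cell vocabulary, harvest/h2-tao-ladder rung1/STAGE2-LEMMA.md §2 and rung1/STAGE3-BANACH.md §1] -/
structure OneShiftFrame (m : ℕ) where
  /-- window width -/
  W : ℕ
  /-- section site -/
  D : ℕ
  /-- box centre (window shells `0 … W-1`) -/
  yc : Fin m → ℤ → ℝ
  /-- box radii (window shells), positive -/
  a : Fin m → ℤ → ℝ
  /-- flight-time centre -/
  τc : ℝ
  /-- flight-time radius -/
  rτ : ℝ
  /-- tail tube centres -/
  tubeC : Fin m → ℤ → ℝ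
  /-- tail tube radii (during the flight) -/
  tubeR : ℤ → ℝ
  /-- metric weights of the tail shells, positive -/
  wt : ℤ → ℝ
  /-- bounded-metric constant: `tubeR k ≤ B wt k` and `|tubeC i k| ≤ B wt k` -/
  B : ℝ
  /-- sup bound of the bottom edge input (wake shell `-1`) -/
  Eb : ℝ
  /-- sup bound of the top edge input (shell `W`) -/
  Et : ℝ
  /-- section level -/
  strig : ℝ
  a_pos : ∀ i k, 0 < a i k
  rτ_pos : 0 < rτ
  τc_gt : rτ < τc
  wt_pos : ∀ k, 0 < wt k
  tubeR_nonneg : ∀ k, 0 ≤ tubeR k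
  tubeR_le : ∀ k, tubeR k ≤ B * wt k
  tubeC_le : ∀ i k, |tubeC i k| ≤ B * wt k

namespace OneShiftFrame

variable (F : OneShiftFrame m)

/-- The end of the flight interval `τ_hi = τc + rτ`. [cite: Tao2016AveragedNS, §5.3 (the epochs); cell vocabulary, harvest/h2-tao-ladder rung1/STAGE2-LEMMA.md §3] -/
def τhi : ℝ := F.τc + F.rτ

/-- The flight interval is non-degenerate. [folklore] -/
theorem τhi_pos : 0 < F.τhi := by
  have := F.τc_gt; have := F.rτ_pos; unfold τhi; linarith

/-- `k` is a window shell (`0 ≤ k < W`; reducible, so that it is decidable by unfolding). [cite: Tao2016AveragedNS, §4; cell vocabulary] -/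
abbrev InWindow (k : ℤ) : Prop := 0 ≤ k ∧ k < F.W

/-- The index type of the tail coordinates: (mode, shell, flight time). [cite: Tao2016AveragedNS, §4; cell vocabulary] -/
abbrev TailIdx : Type := Fin m × ℤ × Icc (0 : ℝ) F.τhi

/-- **The ambient Banach space** (scaled coordinates): window start state, flight time, tail trajectories in
`ℓ^∞` over (mode, shell, time). Its norm is the max of the three sup norms = the weighted sup metric of
STAGE3-BANACH §1 with identity block scales. [cite: Tao2016AveragedNS, §4; cell vocabulary, harvest/h2-tao-ladder rung1/STAGE3-BANACH.md §1] -/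
abbrev Space : Type := (Fin m → Fin F.W → ℝ) × ℝ × lp (fun _ : F.TailIdx => ℝ) ⊤

/-- Decoded window start state `y_{i,k} = ŷ_{i,k} + a_{i,k} ỹ_{i,k}` on the window (`0` elsewhere).
[cite: Tao2016AveragedNS, §4; cell vocabulary, harvest/h2-tao-ladder rung1/STAGE2-LEMMA.md §2 (the box X)] -/
def decodeY (u : F.Space) : Fin m → ℤ → ℝ := fun i k =>
  if h : F.InWindow k then F.yc i k + F.a i k * u.1 i ⟨k.toNat, by
      have h1 := h.1; have h2 := h.2; omega⟩
  else 0

/-- Decoded flight time `τ = τc + rτ τ̃`. [cite: Tao2016AveragedNS, §5.3; cell vocabulary, harvest/h2-tao-ladder rung1/STAGE2-LEMMA.md §2] -/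
def decodeTau (u : F.Space) : ℝ := F.τc + F.rτ * u.2.1

/-- Decoded tail trajectories `T_{i,k}(t) = wt_k · T̃(i, k, t)` for `t ∈ [0, τ_hi]` (clamped in time outside),
meaningful for the tail shells `k ∉ [0, W)`. [cite: Tao2016AveragedNS, §4; cell vocabulary, harvest/h2-tao-ladder rung1/KERNEL-STAGE3-PLAN.md §1] -/
def decodeTail (u : F.Space) : Fin m → ℤ → ℝ → ℝ := fun i k t =>
  F.wt k * (u.2.2 : F.TailIdx → ℝ) (i, k, projIcc 0 F.τhi F.τhi_pos.le t)

/-- **Admissible points**: window start in the box, flight time in `[τc - rτ, τc + rτ]`, tail trajectories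
continuous on the flight, inside their tubes, and the (irrelevant) window-indexed tail coordinates zero.
This is the complete set `𝒦` of STAGE 2/3 in trajectory form. [cite: Tao2016AveragedNS, §4; cell vocabulary, harvest/h2-tao-ladder rung1/STAGE2-LEMMA.md §2, rung1/KERNEL-STAGE3-PLAN.md §1] -/
def Adm (u : F.Space) : Prop :=
  (∀ i k, |u.1 i k| ≤ 1) ∧ |u.2.1| ≤ 1 ∧
  (∀ i k, ¬ F.InWindow k → ContinuousOn (F.decodeTail u i k) (Icc 0 F.τhi)) ∧
  (∀ i k, ¬ F.InWindow k → ∀ t ∈ Icc 0 F.τhi, |F.decodeTail u i k t - F.tubeC i k| ≤ F.tubeR k) ∧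
  (∀ i k, F.InWindow k → ∀ t : Icc (0 : ℝ) F.τhi, (u.2.2 : F.TailIdx → ℝ) (i, k, t) = 0)

/-- Admissible INPUT DATA for the window system: a window start state in the box and tail trajectories that
are continuous on the flight and inside their tubes (what `decodeY`, `decodeTail` of an admissible point are).
[cite: Tao2016AveragedNS, §4; cell vocabulary, harvest/h2-tao-ladder rung1/STAGE2-LEMMA.md §3 (admissible realisations)] -/
def AdmData (y : Fin m → ℤ → ℝ) (T : Fin m → ℤ → ℝ → ℝ) : Prop :=
  (∀ i k, F.InWindow k → |y i k - F.yc i k| ≤ F.a i k) ∧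
  (∀ i k, ¬ F.InWindow k → ContinuousOn (T i k) (Icc 0 F.τhi)) ∧
  (∀ i k, ¬ F.InWindow k → ∀ t ∈ Icc 0 F.τhi, |T i k t - F.tubeC i k| ≤ F.tubeR k)

end OneShiftFrame

/-! ### The renormalisation factor and the window certificate -/

/-- The renormalisation factor of a (pre-shift) state: `g(z) = (Σ_i z_{i,1}²)^{-1/2}` — after the shift, site
`1` becomes site `0` and is normalised to energy `½` (`E_ref = ½`). [cite: Tao2016AveragedNS, §5.3 (rescaling between epochs); cell vocabulary, harvest/h2-tao-ladder rung1/STAGE2-LEMMA.md §2 (g = (E_ref/e(z_1))^{1/2})] -/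
def gfac (z : Fin m → ℤ → ℝ) : ℝ := (Real.sqrt (∑ i, z i 1 ^ 2))⁻¹

/-- Half the squared modulus of shell `k` of a state (`e(z_k)`). [cite: Tao2016AveragedNS, §4 (4.6); cell vocabulary] -/
def shellEnergy (z : Fin m → ℤ → ℝ) (k : ℤ) : ℝ := (1 / 2) * ∑ i, z i k ^ 2

/-- **THE WINDOW CERTIFICATE (hypothesis structure).** What p2's interval engine certifies about the FINITE
window system of frame `F`, table `α`, scale ratio `1+ε₀`, in the form the trajectory-space fixed-point
argument consumes: a map `Φ` sending admissible data (window start `y`, tail trajectories `T`) to a full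
family that agrees with `T` off the window, starts at `y` on the window, and is a `WindowRun` on `S`
(Kb = 0, Ka = W-1: the window equations with the wake shell `-1` and the top shell `W` as continuous bounded
edge inputs) on the whole flight `[0, τ_hi]`; and the Krawczyk map `Nmap` of the window block (engine:
`x ↦ x - C·G(x; inputs)`), opaque except for its FIXED-POINT CHARACTERISATION: a fixed point satisfies the
one-shift relations `g(z) z_{i,k+1} = y_{i,k}` (`k+1 < W`), `g(z) T_{i,W}(τ) = y_{i,W-1}` and the section
`e(z_D) = strig`, where `z` is the window run at time `τ`. The quantitative clauses (H-win: `Nmap` maps the box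
into itself; H-lip: Lipschitz constants; hulls) are hypotheses of the later proof files, not fields.
[cite: Tao2016AveragedNS, §4 Lemma 4.1 (4.8) and §5.3; cell vocabulary, harvest/h2-tao-ladder rung1/STAGE2-LEMMA.md §2–§3 ((H-win)), rung1/STAGE3-BANACH.md §2 ((H-lip)), rung1/KERNEL-STAGE3-PLAN.md §2/§5] -/
structure OneShiftWindowCert (F : OneShiftFrame m) (ε₀ : ℝ)
    (α : Fin m → Fin m → Fin m → ℤ × ℤ × ℤ → ℝ) where
  /-- the window-run map: (start state, tail trajectories) ↦ full family on the flight -/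
  Φ : (Fin m → ℤ → ℝ) → (Fin m → ℤ → ℝ → ℝ) → (Fin m → ℤ → ℝ → ℝ)
  /-- the Krawczyk map of the window block, given the tail trajectories: `(y, τ) ↦ (y', τ')` -/
  Nmap : (Fin m → ℤ → ℝ → ℝ) → (Fin m → ℤ → ℝ) × ℝ → (Fin m → ℤ → ℝ) × ℝ
  /-- off the window `Φ` returns the tails unchanged -/
  Φ_tail : ∀ y T i k, ¬ F.InWindow k → Φ y T i k = T i k
  /-- on the window `Φ` starts at `y` -/
  Φ_init : ∀ y T, F.AdmData y T → ∀ i k, F.InWindow k → Φ y T i k 0 = y i k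
  /-- `Φ` is a window run on the whole flight (window equations, continuous bounded edge inputs) -/
  Φ_run : ∀ y T, F.AdmData y T →
    WindowRun shiftSet ε₀ α 0 ((F.W : ℤ) - 1) F.Eb F.Et F.τhi (Φ y T)
  /-- `Nmap` only returns window states (zero off the window) -/
  Nmap_support : ∀ T y τ i k, ¬ F.InWindow k → (Nmap T (y, τ)).1 i k = 0
  /-- a fixed point of `Nmap` is a one-shift window datum with the section condition -/
  Nmap_fixed : ∀ y T τ, F.AdmData y T → (∀ i k, ¬ F.InWindow k → y i k = 0) →
    τ ∈ Icc (F.τc - F.rτ) (F.τc + F.rτ) → Nmap T (y, τ) = (y, τ) →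
      (∀ i (k : ℤ), 0 ≤ k → k + 1 < F.W →
          gfac (slice (Φ y T) τ) * Φ y T i (k + 1) τ = y i k) ∧
        (∀ i, gfac (slice (Φ y T) τ) * T i F.W τ = y i ((F.W : ℤ) - 1)) ∧
        shellEnergy (slice (Φ y T) τ) F.D = F.strig

/-! ### The map -/

namespace OneShiftFrame

variable (F : OneShiftFrame m)

/-- Clamp a scaled window coordinate / flight time into `[-1, 1]`. [folklore] -/
def clampUnit (x : ℝ) : ℝ := max (-1) (min 1 x)

/-- The unit clamp lands in `[-1, 1]`. [folklore] -/
theorem abs_clampUnit_le (x : ℝ) : |clampUnit x| ≤ 1 := by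
  unfold clampUnit
  rw [abs_le]; constructor
  · exact le_max_left _ _
  · exact max_le (by norm_num) (min_le_left _ _)

/-- The unit clamp is the identity on `[-1, 1]`. [folklore] -/
theorem clampUnit_of_abs_le {x : ℝ} (h : |x| ≤ 1) : clampUnit x = x := by
  unfold clampUnit
  rw [abs_le] at h
  rw [min_eq_right h.2, max_eq_right h.1]

/-- Clamp a scaled tail value of shell `k`, mode `i` into its (scaled) tube
`[(tubeC - tubeR)/wt, (tubeC + tubeR)/wt]` for tail shells, and to `0` for window shells.
[cite: Tao2016AveragedNS, §4; cell vocabulary, harvest/h2-tao-ladder rung1/KERNEL-STAGE3-PLAN.md §1] -/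
def clampTail (i : Fin m) (k : ℤ) (x : ℝ) : ℝ :=
  if F.InWindow k then 0
  else max ((F.tubeC i k - F.tubeR k) / F.wt k) (min ((F.tubeC i k + F.tubeR k) / F.wt k) x)

/-- The tube clamp is uniformly bounded by `2B` (this is what makes the tail block an `ℓ^∞` element with no
hypotheses). [folklore] -/
theorem abs_clampTail_le (i : Fin m) (k : ℤ) (x : ℝ) : |F.clampTail i k x| ≤ 2 * F.B := by
  unfold clampTail
  have hw := F.wt_pos k
  have hB1 := F.tubeR_le k
  have hB2 := F.tubeC_le i k
  have hR0 := F.tubeR_nonneg k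
  have hB0 : 0 ≤ F.B := by nlinarith
  split_ifs with h
  · simp; linarith
  · rw [abs_le] at hB2 ⊢
    have hlo : -(2 * F.B) ≤ (F.tubeC i k - F.tubeR k) / F.wt k := by
      rw [le_div_iff₀ hw]; nlinarith
    have hhi : (F.tubeC i k + F.tubeR k) / F.wt k ≤ 2 * F.B := by
      rw [div_le_iff₀ hw]; nlinarith
    constructor
    · exact hlo.trans (le_max_left _ _)
    · exact max_le (by
        have : (F.tubeC i k - F.tubeR k) / F.wt k ≤ (F.tubeC i k + F.tubeR k) / F.wt k := by
          gcongr; linarith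
        linarith) ((min_le_left _ _).trans hhi)

/-- The tube clamp is the identity inside the tube. [folklore] -/
theorem clampTail_of_mem {i : Fin m} {k : ℤ} (hk : ¬ F.InWindow k) {x : ℝ}
    (h : |F.wt k * x - F.tubeC i k| ≤ F.tubeR k) : F.clampTail i k x = x := by
  unfold clampTail
  rw [if_neg hk]
  have hw := F.wt_pos k
  rw [abs_le] at h
  have h1 : (F.tubeC i k - F.tubeR k) / F.wt k ≤ x := by rw [div_le_iff₀ hw]; linarith
  have h2 : x ≤ (F.tubeC i k + F.tubeR k) / F.wt k := by rw [le_div_iff₀ hw]; linarith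
  rw [min_eq_right h2, max_eq_right h1]

/-- **Pre-clamp**: project any point of `Space` coordinatewise onto the box / tubes (identity on admissible
points, up to the time-continuity clause which clamping preserves). [folklore (coordinatewise retraction onto a box)] -/
def preclampY (u : F.Space) : Fin m → ℤ → ℝ := fun i k =>
  if h : F.InWindow k then F.yc i k + F.a i k * clampUnit (u.1 i ⟨k.toNat, by
      have h1 := h.1; have h2 := h.2; omega⟩)
  else 0

/-- Pre-clamped flight time. [folklore] -/
def preclampTau (u : F.Space) : ℝ := F.τc + F.rτ * clampUnit u.2.1

/-- Pre-clamped tail trajectories (decoded units). [folklore] -/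
def preclampTail (u : F.Space) : Fin m → ℤ → ℝ → ℝ := fun i k t =>
  F.wt k * F.clampTail i k ((u.2.2 : F.TailIdx → ℝ) (i, k, projIcc 0 F.τhi F.τhi_pos.le t))

/-- **The full family of a point**: the window run `Φ` from the (pre-clamped) start state with the
(pre-clamped) tails as edge inputs — window shells from `Φ`, tail shells = the tails themselves (`Φ_tail`).
[cite: Tao2016AveragedNS, §4 Lemma 4.1 (4.8); cell vocabulary, harvest/h2-tao-ladder rung1/KERNEL-STAGE3-PLAN.md §1] -/
def fullFamily {ε₀ : ℝ} {α : Fin m → Fin m → Fin m → ℤ × ℤ × ℤ → ℝ}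
    (cert : OneShiftWindowCert F ε₀ α) (u : F.Space) : Fin m → ℤ → ℝ → ℝ :=
  cert.Φ (F.preclampY u) (F.preclampTail u)

/-- **The raw Picard–shift value** of tail shell `k`, mode `i`, at flight time `t`:
`g(z) · S_{i,k+1}(τ) + ∫_0^t quadTerm_{i,k}(S)(s) ds` with `S` the full family, `τ` the (pre-clamped) flight
time and `z = S(τ)`. A fixed point of the map therefore solves the lattice on the flight (fundamental theorem
of calculus) AND satisfies the one-shift relation `T_{i,k}(0) = g · S_{i,k+1}(τ)`.
[cite: Tao2016AveragedNS, §4 Lemma 4.1 (4.8) and §5.3; cell vocabulary, harvest/h2-tao-ladder rung1/KERNEL-STAGE3-PLAN.md §1 (𝒯_w, 𝒯_t)] -/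
def tailRaw {ε₀ : ℝ} {α : Fin m → Fin m → Fin m → ℤ × ℤ × ℤ → ℝ}
    (cert : OneShiftWindowCert F ε₀ α) (u : F.Space) (i : Fin m) (k : ℤ) (t : ℝ) : ℝ :=
  gfac (slice (F.fullFamily cert u) (F.preclampTau u)) * F.fullFamily cert u i (k + 1) (F.preclampTau u) +
    ∫ s in (0 : ℝ)..t, quadTerm ε₀ α (F.fullFamily cert u) i k s

/-- The scaled, post-clamped tail output as a function on the tail index. [folklore] -/
def tailOutFun {ε₀ : ℝ} {α : Fin m → Fin m → Fin m → ℤ × ℤ × ℤ → ℝ}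
    (cert : OneShiftWindowCert F ε₀ α) (u : F.Space) : F.TailIdx → ℝ := fun p =>
  F.clampTail p.1 p.2.1 (F.tailRaw cert u p.1 p.2.1 (p.2.2 : ℝ) / F.wt p.2.1)

/-- The tail output is bounded (by `2B`), hence an `ℓ^∞` element. [folklore] -/
theorem tailOutFun_memℓp {ε₀ : ℝ} {α : Fin m → Fin m → Fin m → ℤ × ℤ × ℤ → ℝ}
    (cert : OneShiftWindowCert F ε₀ α) (u : F.Space) : Memℓp (F.tailOutFun cert u) ⊤ := by
  refine memℓp_infty ⟨2 * F.B, ?_⟩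
  rintro _ ⟨p, rfl⟩
  show ‖F.tailOutFun cert u p‖ ≤ 2 * F.B
  rw [Real.norm_eq_abs]
  exact F.abs_clampTail_le _ _ _

/-- The tail block of the map as an element of `ℓ^∞`. [folklore] -/
def tailOut {ε₀ : ℝ} {α : Fin m → Fin m → Fin m → ℤ × ℤ × ℤ → ℝ}
    (cert : OneShiftWindowCert F ε₀ α) (u : F.Space) : lp (fun _ : F.TailIdx => ℝ) ⊤ :=
  ⟨F.tailOutFun cert u, F.tailOutFun_memℓp cert u⟩

/-- The window block of the map: the Krawczyk map on the pre-clamped data, re-scaled and post-clamped.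
[cite: Tao2016AveragedNS, §5.3; cell vocabulary, harvest/h2-tao-ladder rung1/STAGE2-LEMMA.md §2 (N = x - C·G), rung1/KERNEL-STAGE3-PLAN.md §1] -/
def windowOut {ε₀ : ℝ} {α : Fin m → Fin m → Fin m → ℤ × ℤ × ℤ → ℝ}
    (cert : OneShiftWindowCert F ε₀ α) (u : F.Space) : (Fin m → Fin F.W → ℝ) × ℝ :=
  let out := cert.Nmap (F.preclampTail u) (F.preclampY u, F.preclampTau u)
  (fun i k => clampUnit ((out.1 i (k : ℤ) - F.yc i k) / F.a i k),
    clampUnit ((out.2 - F.τc) / F.rτ))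

/-- **THE ONE-SHIFT MAP on trajectory space** (total self-map of `Space`, no hypotheses used): window block =
Krawczyk, tail blocks = Picard–shift, all on pre-clamped inputs and post-clamped outputs. On admissible
points, under the STAGE-2 self-map inequalities, every clamp is inactive, so fixed points there are genuine
one-shift data on the flight. [cite: Tao2016AveragedNS, §4–§5; cell vocabulary, harvest/h2-tao-ladder rung1/STAGE3-BANACH.md (𝒯), rung1/KERNEL-STAGE3-PLAN.md §1] -/
def oneShiftMap {ε₀ : ℝ} {α : Fin m → Fin m → Fin m → ℤ × ℤ × ℤ → ℝ}
    (cert : OneShiftWindowCert F ε₀ α) (u : F.Space) : F.Space :=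
  ((F.windowOut cert u).1, (F.windowOut cert u).2, F.tailOut cert u)

/-! ### Basic properties that hold with no hypotheses -/

/-- The window block of the map lands in the unit box (post-clamp). [folklore] -/
theorem abs_oneShiftMap_fst_le {ε₀ : ℝ} {α : Fin m → Fin m → Fin m → ℤ × ℤ × ℤ → ℝ}
    (cert : OneShiftWindowCert F ε₀ α) (u : F.Space) (i : Fin m) (k : Fin F.W) :
    |(F.oneShiftMap cert u).1 i k| ≤ 1 :=
  abs_clampUnit_le _

/-- The flight-time coordinate of the map lands in `[-1, 1]` (post-clamp). [folklore] -/
theorem abs_oneShiftMap_tau_le {ε₀ : ℝ} {α : Fin m → Fin m → Fin m → ℤ × ℤ × ℤ → ℝ}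
    (cert : OneShiftWindowCert F ε₀ α) (u : F.Space) : |(F.oneShiftMap cert u).2.1| ≤ 1 :=
  abs_clampUnit_le _

/-- Unfolding the tail block of the map at a tail index. [folklore] -/
theorem oneShiftMap_tail_apply {ε₀ : ℝ} {α : Fin m → Fin m → Fin m → ℤ × ℤ × ℤ → ℝ}
    (cert : OneShiftWindowCert F ε₀ α) (u : F.Space) (p : F.TailIdx) :
    ((F.oneShiftMap cert u).2.2 : F.TailIdx → ℝ) p =
      F.clampTail p.1 p.2.1 (F.tailRaw cert u p.1 p.2.1 (p.2.2 : ℝ) / F.wt p.2.1) := rfl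

/-- The tail output vanishes on window-indexed coordinates. [folklore] -/
theorem oneShiftMap_tail_window {ε₀ : ℝ} {α : Fin m → Fin m → Fin m → ℤ × ℤ × ℤ → ℝ}
    (cert : OneShiftWindowCert F ε₀ α) (u : F.Space) (i : Fin m) {k : ℤ} (hk : F.InWindow k)
    (t : Icc (0 : ℝ) F.τhi) : ((F.oneShiftMap cert u).2.2 : F.TailIdx → ℝ) (i, k, t) = 0 := by
  rw [oneShiftMap_tail_apply]
  simp [clampTail, hk]

/-- Pre-clamping is the identity on the window start of an admissible point. [folklore] -/
theorem preclampY_eq_decodeY {u : F.Space} (hu : F.Adm u) : F.preclampY u = F.decodeY u := by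
  funext i k
  unfold preclampY decodeY
  split_ifs with h
  · rw [clampUnit_of_abs_le (hu.1 _ _)]
  · rfl

/-- Pre-clamping is the identity on the flight time of an admissible point. [folklore] -/
theorem preclampTau_eq_decodeTau {u : F.Space} (hu : F.Adm u) : F.preclampTau u = F.decodeTau u := by
  unfold preclampTau decodeTau
  rw [clampUnit_of_abs_le hu.2.1]

/-- Pre-clamping is the identity on the tails of an admissible point (tail shells). [folklore] -/
theorem preclampTail_eq_decodeTail {u : F.Space} (hu : F.Adm u) (i : Fin m) {k : ℤ}
    (hk : ¬ F.InWindow k) (t : ℝ) : F.preclampTail u i k t = F.decodeTail u i k t := by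
  unfold preclampTail decodeTail
  congr 1
  apply F.clampTail_of_mem hk
  have ht : (projIcc 0 F.τhi F.τhi_pos.le t : ℝ) ∈ Icc 0 F.τhi := (projIcc 0 F.τhi F.τhi_pos.le t).2
  have := hu.2.2.2.1 i k hk _ ht
  unfold decodeTail at this
  rwa [projIcc_of_mem _ ht] at this

end OneShiftFrame

end DSSOneShift

end Summit.NavierStokesRegularity.NavierStokesRegularity.Theorems
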